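import Literature.Analysis.FluidPDE.SelfSimilarLiouville
import Literature.Analysis.FluidPDE.LocalLeraySolutions
import Literature.Analysis.FunctionSpaces.WeakLp
import HarnessLib

/-!
# Forward discretely self-similar solutions: the architecture of Bradshaw–Tsai 2019, Thm 1.2

Analysis/FluidPDE fact file (trunk FluidKinetic), companion of `SelfSimilarLiouville.lean`, whose
named fact `Literature.Analysis.FluidPDE.bradshawTsai2019_dss_existence` renders

> **Bradshaw–Tsai, Analysis & PDE 12 (2019), Theorem 1.2.** Assume `v₀ ∈ L²_loc(ℝ³)` is a
> divergence free `λ`-DSS vector field for some `λ > 1`. Then there exists a `λ`-DSS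
> distributional solution `v` to (NSE) and associated pressure `π` so that `v` is suitable in the
> sense of [CKN] and `lim_{t→0⁺} ‖v(t) − v₀‖_{L²(K)} = 0` for every compact `K ⊆ ℝ³`; moreover,
> for any `T > 0` and compact `K`, `v ∈ L^∞(0,T;L²(K)) ∩ L²(0,T;H¹(K))` and
> `π ∈ L^{3/2}(0,T;L^{3/2}(K))` [+ an explicit pressure formula, omitted in the rendering].

Discharging that fact needs a weak-solution theory of the Navier–Stokes equations which neither
Mathlib nor `Literature` has (even Leray's 1934 existence theorem is the undischarged fact
`leray_existence_R3`). This file records the **printed proof's architecture** (loc. cit. §3–§4) as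
named facts carrying the paper's own numbering, and **proves the assembly**: the three facts below
imply `bradshawTsai2019_dss_existence` (`bradshawTsai2019_dss_existence_of_parts`). The trust base
of Theorem 1.2 in the tree is thereby split into independently attackable, precisely cited pieces.

## Contents

* `IsBradshawTsai2019Solution c v₀ v π`: the conclusion of Thm 1.2 for a pair `(v, π)` — verbatim
  the body of `bradshawTsai2019_dss_existence` (`bradshawTsai2019_dss_existence_iff` is `Iff.rfl`).
* `bradshawTsai2019_lemma_4_1` (**Lemma 4.1**): a divergence free `λ`-DSS field `f ∈ L²_loc` is the
  `L²(B₁)`-limit of divergence free `λ`-DSS fields `φ⁽ᵏ⁾ ∈ L³_w(ℝ³)` (weak `L³`,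
  `Literature.Analysis.FunctionSpaces.MemWeakLp · 3`). (Printed proof: `λ`-adic partition of
  unity, Bogovskiĭ's right inverse of the divergence on annuli — Lemma 4.2 = [Galdi, III.3] —,
  `C_c^∞` approximation on one annulus and summation over the scaling orbit.)
* `bradshawTsai2017_dss_localLeray_existence` (**Bradshaw–Tsai, Ann. Henri Poincaré 18 (2017)
  [BT1], Theorem 1.2**): every divergence free `λ`-DSS `v₀ ∈ L³_w(ℝ³)` is the datum of a `λ`-DSS
  *local Leray solution* — BT1's Definition 1.1 is Jia–Šverák's (distributional solution with
  `π ∈ L^{3/2}_loc(ℝ³ × [0,∞))`, uniformly local energy bounds, decay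
  `lim_{|x₀|→∞} ∫₀^{R²}∫_{B_R(x₀)} |v|² = 0`, datum in `L²_loc`, CKN suitability), i.e. exactly the
  tree's `IsLocalLeraySolution` (Kang–Miura–Tsai Def. 3.2). BT1's additional estimate
  `‖v(t) − e^{tΔ}v₀‖_{L²} ≤ C₀ t^{1/4}` is omitted (a weakening of the conclusion).
* `bradshawTsai2019_prop_3_1` (**Proposition 3.1**, the new a priori bound, in the form used in
  §4.3): for `λ > 1` and `M ≥ 0` there are `T > 0` and `C` such that every divergence free `λ`-DSS
  `v₀ ∈ L³_w` with `‖v₀‖²_{L²(B_λ)} ≤ M` is the datum of a `λ`-DSS local Leray solution `(v, π)`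
  (the one constructed in [BT1]) with `esssup_{0<t<T} ∫_{B₁}|v|² ≤ C`, `∫₀ᵀ∫_{B₁} |∇v|² ≤ C`,
  `∫₀ᵀ∫_{B₁} |π|^{3/2} ≤ C`. See the design notes for the existential/uniform reading.
* `bradshawTsai2019_limit_4_3` (**§4.3, proof of Thm 1.2, with §4.2**): the passage to the limit —
  given divergence free `λ`-DSS data `w₀⁽ᵏ⁾ ∈ L³_w` with `w₀⁽ᵏ⁾ → v₀` in `L²(B₁)` and `λ`-DSS local
  Leray solutions `(vₖ, πₖ)` with data `w₀⁽ᵏ⁾` obeying the bounds of Prop. 3.1 uniformly in `k`,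
  there is a pair `(v, π)` with `IsBradshawTsai2019Solution λ v₀ v π`.
* Proved: the `L²`-mass scaling law of DSS fields on balls
  (`BradshawTsai2019.setLIntegral_ball_enorm_sq_of_nsRescaleData`, the case `q = 2`, `k = 1` of
  loc. cit. (3.6): `∫_{B_λr} |f|² = λ ∫_{B_r} |f|²`), two integration lemmas, and the assembly
  `bradshawTsai2019_dss_existence_of_parts` (§4.3: approximate `v₀` by Lemma 4.1, drop finitely
  many terms so that `‖φ⁽ᵏ⁾‖²_{L²(B_λ)} ≤ M := λ(2 + 2‖v₀‖²_{L²(B₁)})`, solve with Prop. 3.1, pass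
  to the limit).

## Design notes

* *Representatives.* As in `bradshawTsai2019_dss_existence` (module docstring of
  `SelfSimilarLiouville.lean`, "Forward DSS existence"), discrete self-similarity is the pointwise
  identity `Fluid.IsDiscretelySelfSimilar λ v` on all of `ℝ × ℝ³` / `nsRescaleData λ v₀ = v₀` on
  `ℝ³` (choose the scaling-invariant representative, extend by `0` for `t ≤ 0`; no clause of
  `IsLocalLeraySolution` sees `t ≤ 0`). In hypotheses this is harmless; in conclusions it is the
  representative the sources work with (BT1's `v(x,t) = (2t)^{-1/2} u(x/√(2t), log √(2t))` with a
  time-periodic profile `u`; Lemma 4.1's `φ⁽ᵏ⁾ = Σ_i λ^{-i} φ₀⁽ᵏ⁾(λ^{-i}x)`).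
* *Prop. 3.1 is about the solutions constructed in [BT1]* ("`v` is a `λ`-DSS local Leray solution
  evolving from `v₀` constructed in [BT1] (in particular, it is the limit of the mollified
  approximation scheme)"); the tree cannot name that construction, so the fact is stated in the
  existential form in which §4.3 consumes it: *there is* a `λ`-DSS local Leray solution with the
  bounds. The printed constants are "`T = T(α₀, λ)` and `C(α₀, λ)`, `α₀ = ‖v₀‖²_{L²(B_λ)}`,
  independent of `‖v₀‖_{L²_uloc}` and `‖v₀‖_{L³_w}`"; §4.3 uses them uniformly along a sequence of
  data with bounded `α₀` ("for some `T` which depends only on `λ` and `‖v₀⁽ᵏ⁾‖_{L²(B₁)}`"), which is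
  what the printed proof gives (it only uses `α_ε(0) ≤ α₀`; explicitly `α̃_ε(t) ≤ 2α₀` for
  `t < T = (C(λ)(2 + 8α₀²))⁻¹`). The fact therefore quantifies `∀ M, ∃ T C, ∀ v₀` with
  `‖v₀‖²_{L²(B_λ)} ≤ M`. The pressure formula (3.3) of Prop. 3.1 and Lemma 2.1 are omitted: by
  Remark 2.2 they serve only the pressure formula of Thm 1.2, which the rendering omits.
* *§4.3 as one fact.* The limit step is printed as "As usual (cf. [BT1, KiSe, LR2]), there exists …
  a subsequence … converging weak-star in `L^∞(0,T;L²(B₁))`, weakly in `L²(0,T;H¹(B₁))` and in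
  `L²(0,T;L²(B₁))` …; `πₖ` … converges weakly in `L^{3/2}`"; then the DSS extension of §4.2, the
  attainment of the datum ("for compact subsets of `B₁` automatic", general `K` by rescaling), the
  energy classes by rescaling, and the local energy inequality by lower semicontinuity "(cf.
  [CKN])". It is vendored as a single implication whose hypotheses are exactly what §4.3 has in
  hand after Lemma 4.1, [BT1] and Prop. 3.1 (the data are kept in `L³_w` as in print, although the
  argument does not use it) and whose conclusion is the conclusion of Thm 1.2 as rendered.
* Strict bounds `< C` in print are `≤ C` here (`C` is existentially quantified).
* Lemma 4.1 is printed "for some `λ > 0`"; `λ`-DSS means `λ > 1` throughout the paper (§1), and the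
  fact is stated for `1 < λ`.

## References

* Z. Bradshaw, T.-P. Tsai, *Discretely self-similar solutions to the Navier–Stokes equations with
  data in `L²_loc` satisfying the local energy inequality*, Analysis & PDE 12 (2019) 1943–1962 =
  arXiv:1801.08060: Thm 1.2, Remark 2.2, Prop. 3.1 and its proof ((3.6), (3.12)–(3.14)),
  Lemma 4.1, Lemma 4.2, §4.2, §4.3 [BradshawTsai2019].
* Z. Bradshaw, T.-P. Tsai, *Forward discretely self-similar solutions of the Navier–Stokes
  equations II*, Ann. Henri Poincaré 18 (2017) 1095–1119 = arXiv:1510.07504: Def. 1.1, Thm 1.2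
  [BradshawTsai2017AHP].
* G. P. Galdi, *An introduction to the mathematical theory of the Navier–Stokes equations*, 2nd
  ed. (2011), §III.3 (Bogovskiĭ's formula) — cited by [BradshawTsai2019] as [MR631691] for Lemma 4.2.
* K. Kang, H. Miura, T.-P. Tsai, IMRN 2021, Def. 3.2 (`IsLocalLeraySolution`) [KangMiuraTsai2020].
-/

noncomputable section

open MeasureTheory Set Function Filter Topology TopologicalSpace Metric
open scoped NNReal ENNReal InnerProductSpace RealInnerProductSpace

namespace Literature.Analysis.FluidPDE

/-- Local notation for physical space `ℝ³ = EuclideanSpace ℝ (Fin 3)`. -/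
local notation "ℝ³" => EuclideanSpace ℝ (Fin 3)

/-! ## The conclusion of Theorem 1.2 as a predicate -/

/-- **The conclusion of Bradshaw–Tsai 2019, Thm 1.2** for the scaling factor `c`, the datum `v₀`
and a pair `(v, π)` — verbatim the body of the existential in `bradshawTsai2019_dss_existence`
(`bradshawTsai2019_dss_existence_iff`): `v` is `c`-DSS on `ℝ × ℝ³`; a weak solution with datum
`v₀` on `[0, T)` for every `T > 0`; `(v, π)` is a CKN-suitable weak solution on the open slab
`(0, ∞) × ℝ³`; `∫_K ‖v(t) − v₀‖² → 0` as `t → 0⁺`, `v ∈ L^∞(0,T; L²(K))`, `π ∈ L^{3/2}((0,T) × K)`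
and `∇v ∈ L²((0,T) × K)` (a weak spatial gradient on the slab) for all compact `K` and `T > 0`.
[cite: BradshawTsai2019, Thm 1.2] -/
def IsBradshawTsai2019Solution (c : ℝ) (v₀ : ℝ³ → ℝ³) (v : ℝ → ℝ³ → ℝ³) (π : ℝ → ℝ³ → ℝ) :
    Prop :=
  FluidPDE.IsDiscretelySelfSimilar c v ∧
  (∀ T : ℝ, 0 < T → FluidPDE.IsWeakNSSolutionOn T 1 0 v₀ v) ∧
  FluidPDE.IsSuitableWeakSolutionOn (FluidPDE.slab ℝ³ (Ioi 0) isOpen_Ioi) 1 0 v π ∧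
  (∀ K : Set ℝ³, IsCompact K →
    Tendsto (fun t => ∫⁻ x in K, ‖v t x - v₀ x‖ₑ ^ 2) (𝓝[>] 0) (𝓝 0)) ∧
  (∀ K : Set ℝ³, IsCompact K → ∀ T : ℝ, 0 < T →
    (∃ C : ℝ≥0, ∀ᵐ t ∂(volume.restrict (Ioo 0 T)), ∫⁻ x in K, ‖v t x‖ₑ ^ 2 ≤ C) ∧
    ∫⁻ z in Ioo 0 T ×ˢ K, ‖π z.1 z.2‖ₑ ^ (3 / 2 : ℝ) < (⊤ : ℝ≥0∞)) ∧
  (∃ G : ℝ → ℝ³ → ℝ³ →L[ℝ] ℝ³,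
    FluidPDE.HasWeakSpatialGradientOn (FluidPDE.slab ℝ³ (Ioi 0) isOpen_Ioi) v G ∧
    ∀ K : Set ℝ³, IsCompact K → ∀ T : ℝ, 0 < T →
      ∫⁻ z in Ioo 0 T ×ˢ K, ENNReal.ofReal (FluidPDE.frobeniusNormSq (G z.1 z.2)) < (⊤ : ℝ≥0∞))

/-- `bradshawTsai2019_dss_existence` says precisely: every admissible datum admits a pair `(v, π)`
with `IsBradshawTsai2019Solution` (definitional unfolding). [cite: BradshawTsai2019, Thm 1.2] -/
theorem bradshawTsai2019_dss_existence_iff :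
    bradshawTsai2019_dss_existence ↔
      ∀ {c : ℝ}, 1 < c → ∀ {u₀ : ℝ³ → ℝ³}, AEStronglyMeasurable u₀ volume →
        LocallyIntegrable (fun x => ‖u₀ x‖ ^ 2) volume → FluidPDE.IsWeaklyDivFree u₀ →
          FluidPDE.nsRescaleData c u₀ = u₀ →
        ∃ (u : ℝ → ℝ³ → ℝ³) (p : ℝ → ℝ³ → ℝ), IsBradshawTsai2019Solution c u₀ u p :=
  Iff.rfl

/-! ## The three printed ingredients -/

/-- **Bradshaw–Tsai 2019, Lemma 4.1** (approximation of DSS data): "Let `f ∈ L²_loc(ℝ³; ℝ³)` be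
a given divergence free `λ`-DSS vector field for some `λ > 0` [`λ > 1`, §1]. There exists a
sequence of divergence free `λ`-DSS vector fields `φ⁽ᵏ⁾` so that `φ⁽ᵏ⁾ ∈ L³_w(ℝ³)` and
`‖φ⁽ᵏ⁾ − f‖_{L²(B₁)} → 0` as `k → ∞` (`B₁` is the ball of radius `1` centered at the origin)."
Here `f ∈ L²_loc` is a.e.-strong measurability plus local integrability of `‖f‖²`, divergence
free is `Fluid.IsWeaklyDivFree`, `λ`-DSS is `nsRescaleData λ f = f` (`λ f(λx) = f(x)`), and
`L³_w` is `Literature.Analysis.FunctionSpaces.MemWeakLp · 3 volume`. (Proof in print: `λ`-adic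
partition of unity, Bogovskiĭ correction on annuli — Lemma 4.2 —, `C_c^∞` approximation on one
annulus, summation over the scaling orbit; `|φ⁽ᵏ⁾(x)| ≤ c_k |x|⁻¹`.) [cite: BradshawTsai2019, Lemma 4.1] -/
def bradshawTsai2019_lemma_4_1 : Prop :=
  ∀ {c : ℝ}, 1 < c → ∀ {f : ℝ³ → ℝ³}, AEStronglyMeasurable f volume →
    LocallyIntegrable (fun x => ‖f x‖ ^ 2) volume → FluidPDE.IsWeaklyDivFree f →
      FluidPDE.nsRescaleData c f = f →
    ∃ φ : ℕ → ℝ³ → ℝ³,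
      (∀ k, FunctionSpaces.MemWeakLp (φ k) 3 volume) ∧
      (∀ k, FluidPDE.IsWeaklyDivFree (φ k)) ∧
      (∀ k, FluidPDE.nsRescaleData c (φ k) = φ k) ∧
      Tendsto (fun k => ∫⁻ x in ball (0 : ℝ³) 1, ‖φ k x - f x‖ₑ ^ 2) atTop (𝓝 0)

/-- **Bradshaw–Tsai, Ann. Henri Poincaré 18 (2017) ("[BT1]"), Theorem 1.2** (forward DSS local
Leray solutions for weak-`L³` data): "Let `v₀` be a divergence free, `λ`-DSS vector field for some
`λ > 1` and satisfy `‖v₀‖_{L³_w(ℝ³)} ≤ c₀` for a possibly large constant `c₀`. Then, there exists a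
local Leray solution `v` to (NSE) which is `λ`-DSS and additionally satisfies
`‖v(t) − e^{tΔ}v₀‖_{L²(ℝ³)} ≤ C₀ t^{1/4}` for any `t ∈ (0,∞)` and a constant `C₀ = C₀(v₀)`."
Local Leray solutions are those of BT1's Definition 1.1 (distributional solution with a pressure
`π ∈ L^{3/2}_loc(ℝ³ × [0,∞))`, uniformly local energy bounds, decay at spatial infinity, datum in
`L²_loc`, CKN suitability) = the tree's `IsLocalLeraySolution` (viscosity `1`); the `t^{1/4}`
estimate is omitted here (a weakening of the conclusion). [cite: BradshawTsai2017AHP, Thm 1.2] -/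
def bradshawTsai2017_dss_localLeray_existence : Prop :=
  ∀ {c : ℝ}, 1 < c → ∀ {v₀ : ℝ³ → ℝ³}, FunctionSpaces.MemWeakLp v₀ 3 volume →
    FluidPDE.IsWeaklyDivFree v₀ → FluidPDE.nsRescaleData c v₀ = v₀ →
    ∃ (v : ℝ → ℝ³ → ℝ³) (π : ℝ → ℝ³ → ℝ),
      IsLocalLeraySolution 1 v₀ v π ∧ FluidPDE.IsDiscretelySelfSimilar c v

/-- **Bradshaw–Tsai 2019, Proposition 3.1** (local energy and pressure bounds for the DSS local
Leray solutions of [BT1], depending on the datum only through `α₀ = ‖v₀‖²_{L²(B_λ)}` and `λ`):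
"Fix `λ > 1`. Assume `v₀ ∈ L³_w(ℝ³)` is `λ`-DSS and divergence-free, and `v` is a `λ`-DSS local
Leray solution evolving from `v₀` constructed in [BT1] … and `π` is its associated pressure. Let
`α₀ = ‖v₀‖²_{L²(B_λ)}`. Then, there exist positive `T = T(α₀, λ)` and `C(α₀, λ)` independent of
`‖v₀‖_{L²_uloc}` and `‖v₀‖_{L³_w}` so that
`esssup_{0≤t≤T} ∫_{B₁} |v(x,t)|² dx + ∫₀ᵀ∫_{B₁} |∇v|² dx dt < C(α₀, λ)` and
`∫₀ᵀ∫_{B₁} |π(x,t)|^{3/2} dx dt < C(α₀, λ)`" [+ the pressure formula (3.3), omitted]. Rendered in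
the existential and uniform form in which §4.3 uses it (module docstring, "Prop. 3.1"): for every
`M` there are `T > 0` and `C` serving all such data with `‖v₀‖²_{L²(B_λ)} ≤ M`, and for each of them
*there is* a `λ`-DSS local Leray solution `(v, π)` with datum `v₀` ([BT1], Thm 1.2 =
`bradshawTsai2017_dss_localLeray_existence`) obeying the three bounds (`∇v` = a weak spatial
gradient `G` of `v` on the slab `(0,∞) × ℝ³`, measured by `Fluid.frobeniusNormSq`). [cite: BradshawTsai2019, Prop 3.1] -/
def bradshawTsai2019_prop_3_1 : Prop :=
  ∀ {c : ℝ}, 1 < c → ∀ M : ℝ≥0, ∃ T : ℝ, 0 < T ∧ ∃ C : ℝ≥0, ∀ {v₀ : ℝ³ → ℝ³},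
    FunctionSpaces.MemWeakLp v₀ 3 volume → FluidPDE.IsWeaklyDivFree v₀ →
      FluidPDE.nsRescaleData c v₀ = v₀ → ∫⁻ x in ball (0 : ℝ³) c, ‖v₀ x‖ₑ ^ 2 ≤ M →
    ∃ (v : ℝ → ℝ³ → ℝ³) (π : ℝ → ℝ³ → ℝ),
      IsLocalLeraySolution 1 v₀ v π ∧ FluidPDE.IsDiscretelySelfSimilar c v ∧
      (∀ᵐ t ∂(volume.restrict (Ioo 0 T)), ∫⁻ x in ball (0 : ℝ³) 1, ‖v t x‖ₑ ^ 2 ≤ C) ∧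
      (∃ G : ℝ → ℝ³ → ℝ³ →L[ℝ] ℝ³,
        FluidPDE.HasWeakSpatialGradientOn (FluidPDE.slab ℝ³ (Ioi 0) isOpen_Ioi) v G ∧
        ∫⁻ z in Ioo 0 T ×ˢ ball (0 : ℝ³) 1,
          ENNReal.ofReal (FluidPDE.frobeniusNormSq (G z.1 z.2)) ≤ C) ∧
      ∫⁻ z in Ioo 0 T ×ˢ ball (0 : ℝ³) 1, ‖π z.1 z.2‖ₑ ^ (3 / 2 : ℝ) ≤ C

/-- **Bradshaw–Tsai 2019, §4.3 (proof of Theorem 1.2), with the extension principle of §4.2**: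
the passage to the limit. Let `λ > 1` and let `v₀ ∈ L²_loc` be divergence free and `λ`-DSS. Let
`w₀⁽ᵏ⁾ ∈ L³_w` be divergence free `λ`-DSS data with `‖w₀⁽ᵏ⁾ − v₀‖_{L²(B₁)} → 0` (Lemma 4.1) and let
`(vₖ, πₖ)` be `λ`-DSS local Leray solutions with data `w₀⁽ᵏ⁾` ([BT1]) which, for some `T > 0` and
`C`, obey uniformly in `k` the bounds of Prop. 3.1: `esssup_{0<t<T} ∫_{B₁}|vₖ(t)|² ≤ C`,
`∫₀ᵀ∫_{B₁} |∇vₖ|² ≤ C`, `∫₀ᵀ∫_{B₁} |πₖ|^{3/2} ≤ C`. Then ("As usual (cf. [BT1, KiSe, LR2]), there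
exists a distribution `v` and a subsequence … `vₖ` converges to `v` in the weak star topology on
`L^∞(0,T;L²(B₁))`, in the weak topology on `L²(0,T;H¹(B₁))`, and in `L²(0,T;L²(B₁))` … we may
extract a subsequence [of `πₖ`] which converges weakly to … `π ∈ L^{3/2}(0,T;L^{3/2}(B₁))` …
`v` can be extended to a DSS solution on `ℝ³ × (0,∞)` [§4.2] … `lim_{t→0⁺} ‖v(t) − v₀‖_{L²(K)} = 0`
for every compact set `K` … `v ∈ L^∞(0,T';L²(K)) ∩ L²(0,T';H¹(K))` and
`π ∈ L^{3/2}(0,T';L^{3/2}(K))` for any `T' > 0` and compact `K` … The local energy inequality for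
`v` plainly follows [by lower semicontinuity, cf. [CKN]]") there is a pair `(v, π)` satisfying the
conclusion of Theorem 1.2 for the datum `v₀`, `IsBradshawTsai2019Solution λ v₀ v π`. [cite: BradshawTsai2019, §4.3 (proof of Thm 1.2) and §4.2] -/
def bradshawTsai2019_limit_4_3 : Prop :=
  ∀ {c : ℝ}, 1 < c → ∀ {v₀ : ℝ³ → ℝ³}, AEStronglyMeasurable v₀ volume →
    LocallyIntegrable (fun x => ‖v₀ x‖ ^ 2) volume → FluidPDE.IsWeaklyDivFree v₀ →
      FluidPDE.nsRescaleData c v₀ = v₀ →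
    ∀ {w₀ : ℕ → ℝ³ → ℝ³} {v : ℕ → ℝ → ℝ³ → ℝ³} {π : ℕ → ℝ → ℝ³ → ℝ} {T : ℝ} {C : ℝ≥0},
    (∀ k, FunctionSpaces.MemWeakLp (w₀ k) 3 volume) → (∀ k, FluidPDE.IsWeaklyDivFree (w₀ k)) →
    (∀ k, FluidPDE.nsRescaleData c (w₀ k) = w₀ k) →
    Tendsto (fun k => ∫⁻ x in ball (0 : ℝ³) 1, ‖w₀ k x - v₀ x‖ₑ ^ 2) atTop (𝓝 0) →
    (∀ k, IsLocalLeraySolution 1 (w₀ k) (v k) (π k)) →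
    (∀ k, FluidPDE.IsDiscretelySelfSimilar c (v k)) →
    0 < T →
    (∀ k, ∀ᵐ t ∂(volume.restrict (Ioo 0 T)), ∫⁻ x in ball (0 : ℝ³) 1, ‖v k t x‖ₑ ^ 2 ≤ C) →
    (∀ k, ∃ G : ℝ → ℝ³ → ℝ³ →L[ℝ] ℝ³,
      FluidPDE.HasWeakSpatialGradientOn (FluidPDE.slab ℝ³ (Ioi 0) isOpen_Ioi) (v k) G ∧
      ∫⁻ z in Ioo 0 T ×ˢ ball (0 : ℝ³) 1,
        ENNReal.ofReal (FluidPDE.frobeniusNormSq (G z.1 z.2)) ≤ C) →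
    (∀ k, ∫⁻ z in Ioo 0 T ×ˢ ball (0 : ℝ³) 1, ‖π k z.1 z.2‖ₑ ^ (3 / 2 : ℝ) ≤ C) →
    ∃ (u : ℝ → ℝ³ → ℝ³) (p : ℝ → ℝ³ → ℝ), IsBradshawTsai2019Solution c v₀ u p

/-- Proposition 3.1 (as rendered, with the existence clause of [BT1]) contains [BT1]'s Theorem 1.2
for data with finite `L²(B_λ)`-mass — which every `L³_w` field has (`L^{3,∞} ⊂ L²_loc`), but that
embedding is not proved here, so the finiteness is kept as a hypothesis. [cite: BradshawTsai2019, Prop 3.1] -/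
theorem bradshawTsai2019_prop_3_1.exists_isLocalLeraySolution (h : bradshawTsai2019_prop_3_1)
    {c : ℝ} (hc : 1 < c) {v₀ : ℝ³ → ℝ³} (hw : FunctionSpaces.MemWeakLp v₀ 3 volume)
    (hdiv : FluidPDE.IsWeaklyDivFree v₀) (hdss : FluidPDE.nsRescaleData c v₀ = v₀)
    (hfin : ∫⁻ x in ball (0 : ℝ³) c, ‖v₀ x‖ₑ ^ 2 < ⊤) :
    ∃ (v : ℝ → ℝ³ → ℝ³) (π : ℝ → ℝ³ → ℝ),
      IsLocalLeraySolution 1 v₀ v π ∧ FluidPDE.IsDiscretelySelfSimilar c v := by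
  obtain ⟨T, -, C, hTC⟩ := h hc (∫⁻ x in ball (0 : ℝ³) c, ‖v₀ x‖ₑ ^ 2).toNNReal
  obtain ⟨v, π, hv, hdssv, -⟩ := hTC hw hdiv hdss (ENNReal.coe_toNNReal hfin.ne).ge
  exact ⟨v, π, hv, hdssv⟩

/-! ## Proved glue: the `L²`-mass of DSS fields on balls -/

namespace BradshawTsai2019

/-- Change of variables `x = c y` (`c > 0`) for the Lebesgue integral on balls of `ℝ³` centred at
the origin: `∫⁻_{B_{cr}} F(x) dx = c³ ∫⁻_{B_r} F(cy) dy` (Mathlib `Measure.map_addHaar_smul`). [folklore] -/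
theorem setLIntegral_ball_comp_smul (F : ℝ³ → ℝ≥0∞) {c : ℝ} (hc : 0 < c) (r : ℝ) :
    ∫⁻ x in ball (0 : ℝ³) (c * r), F x =
      ENNReal.ofReal (c ^ 3) * ∫⁻ y in ball (0 : ℝ³) r, F (c • y) := by
  have hc0 : c ≠ 0 := hc.ne'
  have he : MeasurableEmbedding (fun x : ℝ³ => c • x) :=
    (Homeomorph.smul (isUnit_iff_ne_zero.2 hc0).unit).toMeasurableEquiv.measurableEmbedding
  have hpre : (fun x : ℝ³ => c • x) ⁻¹' ball (0 : ℝ³) (c * r) = ball 0 r := by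
    ext x
    simp only [mem_preimage, mem_ball_zero_iff, norm_smul, Real.norm_eq_abs, abs_of_pos hc]
    exact ⟨fun h => lt_of_mul_lt_mul_left h hc.le, fun h => mul_lt_mul_of_pos_left h hc⟩
  have h1 : ∫⁻ y in ball (0 : ℝ³) r, F (c • y) =
      ∫⁻ x in ball (0 : ℝ³) (c * r), F x ∂(Measure.map (fun x : ℝ³ => c • x) volume) := by
    rw [he.restrict_map, he.lintegral_map, hpre]
  rw [h1, Measure.map_addHaar_smul volume hc0, Measure.restrict_smul, lintegral_smul_measure,
    finrank_euclideanSpace_fin, smul_eq_mul, ← mul_assoc, abs_of_nonneg (by positivity),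
    ← ENNReal.ofReal_mul (by positivity), mul_inv_cancel₀ (pow_ne_zero 3 hc0), ENNReal.ofReal_one,
    one_mul]

/-- **Scaling law of the local `L²`-mass of a DSS field** (Bradshaw–Tsai 2019, (3.6) with `q = 2`,
`k = 1`, for data): if `c f(cx) = f(x)` for all `x` (`c > 0`) then
`∫_{B_{cr}} |f|² = c ∫_{B_r} |f|²`. [cite: BradshawTsai2019, (3.6)] -/
theorem setLIntegral_ball_enorm_sq_of_nsRescaleData {f : ℝ³ → ℝ³} {c : ℝ} (hc : 0 < c)
    (hf : FluidPDE.nsRescaleData c f = f) (r : ℝ) :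
    ∫⁻ x in ball (0 : ℝ³) (c * r), ‖f x‖ₑ ^ 2 =
      ENNReal.ofReal c * ∫⁻ x in ball (0 : ℝ³) r, ‖f x‖ₑ ^ 2 := by
  have hc0 : c ≠ 0 := hc.ne'
  have hpt : ∀ y : ℝ³, f (c • y) = c⁻¹ • f y := fun y => by
    have h := congrFun hf y
    rw [FluidPDE.nsRescaleData_apply] at h
    rw [← h, smul_smul, inv_mul_cancel₀ hc0, one_smul]
  rw [setLIntegral_ball_comp_smul _ hc]
  simp_rw [hpt, enorm_smul, Real.enorm_eq_ofReal (inv_nonneg.2 hc.le), mul_pow]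
  rw [lintegral_const_mul' _ _ (by simp), ← mul_assoc, ← ENNReal.ofReal_pow (inv_nonneg.2 hc.le),
    ← ENNReal.ofReal_mul (by positivity)]
  congr 2
  rw [inv_pow, ← div_eq_mul_inv, div_eq_iff (pow_ne_zero 2 hc0)]
  ring

/-- `‖a‖ₑ² ≤ 2‖a − b‖ₑ² + 2‖b‖ₑ²` (the parallelogram-type bound in `ℝ≥0∞`). [folklore] -/
theorem enorm_sq_le_two_mul_sub_sq_add (a b : ℝ³) :
    ‖a‖ₑ ^ 2 ≤ 2 * ‖a - b‖ₑ ^ 2 + 2 * ‖b‖ₑ ^ 2 := by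
  have hr : ‖a‖ ^ 2 ≤ 2 * ‖a - b‖ ^ 2 + 2 * ‖b‖ ^ 2 := by
    have h1 : ‖a‖ ≤ ‖a - b‖ + ‖b‖ := norm_le_norm_sub_add a b
    nlinarith [norm_nonneg a, norm_nonneg (a - b), norm_nonneg b, sq_nonneg (‖a - b‖ - ‖b‖)]
  calc ‖a‖ₑ ^ 2 = ENNReal.ofReal (‖a‖ ^ 2) := by
        rw [ENNReal.ofReal_pow (norm_nonneg _), ofReal_norm]
    _ ≤ ENNReal.ofReal (2 * ‖a - b‖ ^ 2 + 2 * ‖b‖ ^ 2) := ENNReal.ofReal_le_ofReal hr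
    _ = 2 * ‖a - b‖ₑ ^ 2 + 2 * ‖b‖ₑ ^ 2 := by
        rw [ENNReal.ofReal_add (by positivity) (by positivity), ENNReal.ofReal_mul zero_le_two,
          ENNReal.ofReal_mul zero_le_two, ENNReal.ofReal_pow (norm_nonneg _),
          ENNReal.ofReal_pow (norm_nonneg _), ofReal_norm, ofReal_norm,
          ENNReal.ofReal_ofNat]

/-- `∫_s ‖f‖² ≤ 2 ∫_s ‖f − g‖² + 2 ∫_s ‖g‖²` for a.e.-strongly measurable `f`, `g`. [folklore] -/
theorem setLIntegral_enorm_sq_le_two_mul {f g : ℝ³ → ℝ³} (s : Set ℝ³)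
    (hf : AEStronglyMeasurable f volume) (hg : AEStronglyMeasurable g volume) :
    ∫⁻ x in s, ‖f x‖ₑ ^ 2 ≤
      2 * (∫⁻ x in s, ‖f x - g x‖ₑ ^ 2) + 2 * ∫⁻ x in s, ‖g x‖ₑ ^ 2 := by
  have hmeas : AEMeasurable (fun x => 2 * ‖f x - g x‖ₑ ^ 2) (volume.restrict s) :=
    (((hf.sub hg).restrict).enorm.pow_const 2).const_mul 2
  calc ∫⁻ x in s, ‖f x‖ₑ ^ 2
      ≤ ∫⁻ x in s, (2 * ‖f x - g x‖ₑ ^ 2 + 2 * ‖g x‖ₑ ^ 2) :=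
        lintegral_mono fun x => enorm_sq_le_two_mul_sub_sq_add (f x) (g x)
    _ = 2 * (∫⁻ x in s, ‖f x - g x‖ₑ ^ 2) + 2 * ∫⁻ x in s, ‖g x‖ₑ ^ 2 := by
        rw [lintegral_add_left' hmeas, lintegral_const_mul' _ _ ENNReal.ofNat_ne_top,
          lintegral_const_mul' _ _ ENNReal.ofNat_ne_top]

/-- A field with locally integrable `‖·‖²` has finite `L²`-mass on every ball. [folklore] -/
theorem setLIntegral_ball_enorm_sq_lt_top {u₀ : ℝ³ → ℝ³}
    (h : LocallyIntegrable (fun x => ‖u₀ x‖ ^ 2) volume) (r : ℝ) :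
    ∫⁻ x in ball (0 : ℝ³) r, ‖u₀ x‖ₑ ^ 2 < ⊤ := by
  have hint : IntegrableOn (fun x => ‖u₀ x‖ ^ 2) (ball (0 : ℝ³) r) volume :=
    (h.integrableOn_isCompact (isCompact_closedBall (0 : ℝ³) r)).mono_set ball_subset_closedBall
  have hfin := hint.hasFiniteIntegral
  rw [hasFiniteIntegral_iff_enorm] at hfin
  refine lt_of_eq_of_lt (lintegral_congr fun x => ?_) hfin
  rw [Real.enorm_eq_ofReal (sq_nonneg _), ENNReal.ofReal_pow (norm_nonneg _), ofReal_norm]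

end BradshawTsai2019

/-! ## The assembly: Lemma 4.1 + Prop. 3.1 (with [BT1]) + §4.3 ⟹ Theorem 1.2 -/

/-- **Assembly of Bradshaw–Tsai 2019, Theorem 1.2 from its printed ingredients** (§4.3): given the
datum `v₀`, take the `L³_w` approximants `φ⁽ᵏ⁾` of Lemma 4.1; since `‖φ⁽ᵏ⁾ − v₀‖_{L²(B₁)} → 0`,
after dropping finitely many terms `‖φ⁽ᵏ⁾‖²_{L²(B₁)} ≤ 2 + 2‖v₀‖²_{L²(B₁)}`, hence by the DSS scaling
law `‖φ⁽ᵏ⁾‖²_{L²(B_λ)} ≤ M := λ(2 + 2‖v₀‖²_{L²(B₁)})` uniformly in `k` ("the values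
`‖v₀⁽ᵏ⁾‖_{L²(B₁)}` are uniformly bounded"); Prop. 3.1 (with [BT1]) yields `λ`-DSS local Leray
solutions `(vₖ, πₖ)` with data `φ⁽ᵏ⁾` and bounds uniform in `k` on `B₁ × (0, T)`; the limit step of
§4.3 produces the solution. Hence the trust base of `bradshawTsai2019_dss_existence` is
`{bradshawTsai2019_lemma_4_1, bradshawTsai2019_prop_3_1, bradshawTsai2019_limit_4_3}`. [cite: BradshawTsai2019, §4.3 (proof of Thm 1.2)] -/
theorem bradshawTsai2019_dss_existence_of_parts (h41 : bradshawTsai2019_lemma_4_1)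
    (h31 : bradshawTsai2019_prop_3_1) (h43 : bradshawTsai2019_limit_4_3) :
    bradshawTsai2019_dss_existence := by
  intro c hc u₀ hmeas hL2 hdiv hdss
  obtain ⟨φ, hφw, hφdiv, hφdss, hφlim⟩ := h41 hc hmeas hL2 hdiv hdss
  have hc0 : 0 < c := zero_lt_one.trans hc
  -- finiteness of the `L²(B₁)`-mass of the datum
  have hI₀ : ∫⁻ x in ball (0 : ℝ³) 1, ‖u₀ x‖ₑ ^ 2 < ⊤ :=
    BradshawTsai2019.setLIntegral_ball_enorm_sq_lt_top hL2 1
  -- drop finitely many terms: eventually `∫_{B₁} ‖φ k − u₀‖² ≤ 1`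
  obtain ⟨N, hN⟩ : ∃ N, ∀ k ≥ N, ∫⁻ x in ball (0 : ℝ³) 1, ‖φ k x - u₀ x‖ₑ ^ 2 ≤ 1 :=
    eventually_atTop.1 (hφlim.eventually_mem (Iic_mem_nhds zero_lt_one))
  -- the uniform bound on `B_c` via the DSS scaling law
  have hbound : ∀ k, ∫⁻ x in ball (0 : ℝ³) c, ‖φ (k + N) x‖ₑ ^ 2 ≤
      ENNReal.ofReal c * (2 * 1 + 2 * ∫⁻ x in ball (0 : ℝ³) 1, ‖u₀ x‖ₑ ^ 2) := by
    intro k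
    have h1 : ∫⁻ x in ball (0 : ℝ³) 1, ‖φ (k + N) x‖ₑ ^ 2 ≤
        2 * 1 + 2 * ∫⁻ x in ball (0 : ℝ³) 1, ‖u₀ x‖ₑ ^ 2 :=
      (BradshawTsai2019.setLIntegral_enorm_sq_le_two_mul _ (hφw _).aestronglyMeasurable
        hmeas).trans (add_le_add (mul_le_mul_right (hN _ (N.le_add_left k)) 2) le_rfl)
    have h2 := BradshawTsai2019.setLIntegral_ball_enorm_sq_of_nsRescaleData hc0 (hφdss (k + N)) 1
    rw [mul_one] at h2
    rw [h2]
    exact mul_le_mul_right h1 _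
  have hMfin : ENNReal.ofReal c * (2 * 1 + 2 * ∫⁻ x in ball (0 : ℝ³) 1, ‖u₀ x‖ₑ ^ 2) ≠ ⊤ :=
    ENNReal.mul_ne_top ENNReal.ofReal_ne_top (ENNReal.add_ne_top.2
      ⟨ENNReal.mul_ne_top ENNReal.ofNat_ne_top ENNReal.one_ne_top,
        ENNReal.mul_ne_top ENNReal.ofNat_ne_top hI₀.ne⟩)
  obtain ⟨T, hT, C, hTC⟩ := h31 hc
    (ENNReal.ofReal c * (2 * 1 + 2 * ∫⁻ x in ball (0 : ℝ³) 1, ‖u₀ x‖ₑ ^ 2)).toNNReal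
  have hex : ∀ k, ∃ (v : ℝ → ℝ³ → ℝ³) (π : ℝ → ℝ³ → ℝ),
      IsLocalLeraySolution 1 (φ (k + N)) v π ∧ FluidPDE.IsDiscretelySelfSimilar c v ∧
      (∀ᵐ t ∂(volume.restrict (Ioo 0 T)), ∫⁻ x in ball (0 : ℝ³) 1, ‖v t x‖ₑ ^ 2 ≤ C) ∧
      (∃ G : ℝ → ℝ³ → ℝ³ →L[ℝ] ℝ³,
        FluidPDE.HasWeakSpatialGradientOn (FluidPDE.slab ℝ³ (Ioi 0) isOpen_Ioi) v G ∧
        ∫⁻ z in Ioo 0 T ×ˢ ball (0 : ℝ³) 1,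
          ENNReal.ofReal (FluidPDE.frobeniusNormSq (G z.1 z.2)) ≤ C) ∧
      ∫⁻ z in Ioo 0 T ×ˢ ball (0 : ℝ³) 1, ‖π z.1 z.2‖ₑ ^ (3 / 2 : ℝ) ≤ C := fun k =>
    hTC (hφw _) (hφdiv _) (hφdss _) ((hbound k).trans_eq (ENNReal.coe_toNNReal hMfin).symm)
  choose v π hv using hex
  exact h43 hc hmeas hL2 hdiv hdss (w₀ := fun k => φ (k + N)) (v := v) (π := π) (T := T) (C := C)
    (fun k => hφw _) (fun k => hφdiv _) (fun k => hφdss _)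
    (hφlim.comp (tendsto_add_atTop_nat N)) (fun k => (hv k).1) (fun k => (hv k).2.1) hT
    (fun k => (hv k).2.2.1) (fun k => (hv k).2.2.2.1) (fun k => (hv k).2.2.2.2)

end Literature.Analysis.FluidPDE

end
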